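import Summits.Ventures.Crystal3D.Theorems.StickyWulffConstantTextureLiminfBilayerWallBookkeeping
import Summits.Ventures.Crystal3D.Theorems.StickyWulffConstantTextureLiminfTexShadowSplitDefs
import Summits.Ventures.Crystal3D.Theorems.StickyWulffConstantTextureLiminfChargeFlux
import HarnessLib

/-!
# The two-plate wall law AT ZERO CHARGE holds for EVERY pair of Barlow plates (kissing number + inner-face bookkeeping)
# (lane T, crux `TextureLiminf`, stmt-Ventures-19483; the `Q = 0` core of the on-reach class `BilayerWallOnReachZig`(a), cf-p1 §86(106a))

HONEST FRAMING. Venture `Summits/Ventures/Crystal3D` (cell `crystal3d-full`), helper `--supports` the crux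
`TextureLiminf` (stmt-Ventures-19483) of `route-Ventures-StickyWulffConstant`, registered line `TexShadow` (v6.12).  Rung
credit only; F-C1 not moved.  NOT the wall law with charges: the CHARGE-FREE cell inequality only.

QUESTION (cf-p1 18:21:08Z): is the co-Barlow basal `Q = 0` cell inequality covered by the skeleton's one-plate `BarlowAdhesionR`?
ANSWER: not literally — `BarlowAdhesionR` is a ONE-plate statement; applied to both plates it double-counts the filling's deficiency
`D(F)` (each application may spend all of it), and it carries a continuation term the two-plate cell does not have.  But NO adhesion
theorem is needed at zero charge: with `Q = 0` the cell inequality `cross₁ + cross₂ ≤ D(F) + ½·innerBonds₁ + ½·innerBonds₂ + C(1+h)ρ`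
is the kissing number.  Indeed `2·D(F) = 12·#F − 2·b(F) ≥ cross₁ + cross₂` needs only `deg ≤ 12` at filling balls, and `cross_g ≤
innerBonds_g + rim` only plate completeness — which is exactly what g13's INNER-FACE BOOKKEEPING `payerSum_le_currency` /
`bilayerWallAt_of_payerBound` (p641446) proved in general: `2Q ≤ Σ_PAY(12 − deg) + C'(1+h)ρ ⇒ BilayerWallAt`; at `Q = 0` the
hypothesis is `0 ≤ Σ_PAY (12 − deg)`, i.e. `card_filter_dist_eq_one_le_twelve` (the kissing number of `ℝ³`, Musin).

* **`bilayerWallAt_zero_table`** — `BilayerWallAt ((3456 + 1152(R₀+1))/2) R₀ σ₁ σ₂ L₁ L₂ s₁ s₂ 0` for EVERY Hägg pair, frame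
  pair, origin pair, `R₀ ≥ 3`;
* `BilayerWallZeroCharge C R₀` (named Prop, for ROUTE §87) and **`bilayerWallZeroCharge_holds`**;
* `bilayerWallAt_of_charges_zero`, **`bilayerWallAt_of_equal_lattices`** (all facing bilayer lattices equal ⇒ every admissible table
  vanishes ⇒ the cell inequality), **`bilayerWallAt_same_presentation`** (both plates cut from ONE presented stacking `(L, s, σ)`,
  frames `A₁ = A₂`: off-diagonal slab pairs have empty intersection (`disjoint_laySlab`), diagonal charges vanish ⇒ the cell
  inequality for EVERY admissible table) — the co-Barlow / identical-crystal cells of `BilayerWallOnReachZig`(a) are CLOSED.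
What is NOT closed here: on-reach pairs with POSITIVE admissible charge (coincidence twists, c = 1; registered co-axial twins,
c = ½ sin∠(e₃, c) > 0 — lane F's registered class read for Barlow plates).
WHAT THIS IS NOT: not the wall law at positive charge; F-C1 not moved.
-/

noncomputable section

namespace Summit.Ventures.Crystal3D.Cruxes.TextureLiminf.TexShadow

open Literature.MathematicalPhysics.StatisticalMechanics (IsHaggSeq)

/-- **The two-plate wall law at ZERO CHARGE** at constants `(C, R₀)`: the cell inequality with the zero table for every pair of
Barlow plates (named for ROUTE §87; PROVED below for `R₀ ≥ 3`, `C = (3456 + 1152(R₀+1))/2`). -/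
def BilayerWallZeroCharge (C R₀ : ℝ) : Prop :=
  ∀ (σ₁ σ₂ : ℤ → ℤ), IsHaggSeq σ₁ → IsHaggSeq σ₂ → ∀ (L₁ L₂ : E3 ≃ₗᵢ[ℝ] E3) (s₁ s₂ : E3),
    BilayerWallAt C R₀ σ₁ σ₂ L₁ L₂ s₁ s₂ (fun _ _ => 0)

end Summit.Ventures.Crystal3D.Cruxes.TextureLiminf.TexShadow

namespace Summit.Ventures.Crystal3D.Theorems

open MeasureTheory Set Finset
open scoped ENNReal InnerProductSpace
open Literature.MathematicalPhysics.StatisticalMechanics (IsHaggSeq)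
open Summit.Ventures.Crystal3D.Cruxes.TextureLiminf.TexShadow (E3 e₃ cyl stacking laySlab fccRef BilayerWallAt
  BilayerChargeAdmissible BilayerWallZeroCharge)

/-- **The cell inequality with the ZERO table**, for every pair of Barlow plates (`R₀ ≥ 3`). -/
theorem bilayerWallAt_zero_table {σ₁ σ₂ : ℤ → ℤ} (hσ₁ : IsHaggSeq σ₁) (hσ₂ : IsHaggSeq σ₂)
    (L₁ L₂ : E3 ≃ₗᵢ[ℝ] E3) (s₁ s₂ : E3) (R₀ : ℝ) (hR₀ : 3 ≤ R₀) :
    BilayerWallAt ((3456 + 1152 * (R₀ + 1)) / 2) R₀ σ₁ σ₂ L₁ L₂ s₁ s₂ (fun _ _ => 0) := by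
  classical
  have h := bilayerWallAt_of_payerBound hσ₁ hσ₂ L₁ L₂ s₁ s₂ R₀ 0 hR₀ (fun _ _ => 0) ?_
  · rwa [zero_add] at h
  intro h hh ρ hρ X P₁ P₂ hX _hP₁X _hP₂X _hcell _hP₁ _hP₂
  simp only [zero_mul, tsum_zero, mul_zero, add_zero]
  exact Finset.sum_nonneg fun y _ => sub_nonneg.2 (by exact_mod_cast card_filter_dist_eq_one_le_twelve X hX y)

/-- **`BilayerWallZeroCharge` holds** from thickness `3` on. -/
theorem bilayerWallZeroCharge_holds (R₀ : ℝ) (hR₀ : 3 ≤ R₀) : BilayerWallZeroCharge ((3456 + 1152 * (R₀ + 1)) / 2) R₀ :=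
  fun _ _ hσ₁ hσ₂ L₁ L₂ s₁ s₂ => bilayerWallAt_zero_table hσ₁ hσ₂ L₁ L₂ s₁ s₂ R₀ hR₀

/-- A table that vanishes identically. -/
theorem bilayerWallAt_of_charges_zero {σ₁ σ₂ : ℤ → ℤ} (hσ₁ : IsHaggSeq σ₁) (hσ₂ : IsHaggSeq σ₂)
    (L₁ L₂ : E3 ≃ₗᵢ[ℝ] E3) (s₁ s₂ : E3) (R₀ : ℝ) (hR₀ : 3 ≤ R₀) {c : ℤ → ℤ → ℝ} (hc : ∀ i j, c i j = 0) :
    BilayerWallAt ((3456 + 1152 * (R₀ + 1)) / 2) R₀ σ₁ σ₂ L₁ L₂ s₁ s₂ c := by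
  have hc' : c = fun _ _ => 0 := funext fun i => funext fun j => hc i j
  rw [hc']
  exact bilayerWallAt_zero_table hσ₁ hσ₂ L₁ L₂ s₁ s₂ R₀ hR₀

/-- **Equal facing lattices ⇒ the cell inequality** (every admissible table vanishes by the fourth clause of
`BilayerChargeAdmissible`). -/
theorem bilayerWallAt_of_equal_lattices {σ₁ σ₂ : ℤ → ℤ} (hσ₁ : IsHaggSeq σ₁) (hσ₂ : IsHaggSeq σ₂)
    (L₁ L₂ : E3 ≃ₗᵢ[ℝ] E3) (s₁ s₂ : E3) (R₀ : ℝ) (hR₀ : 3 ≤ R₀) {A₁ A₂ : ℤ → (E3 ≃ₗᵢ[ℝ] E3)} {c : ℤ → ℤ → ℝ}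
    {m : ℤ → ℤ → E3} (hadm : BilayerChargeAdmissible A₁ A₂ c m) (heq : ∀ i j : ℤ, A₁ i '' fccRef = A₂ j '' fccRef) :
    BilayerWallAt ((3456 + 1152 * (R₀ + 1)) / 2) R₀ σ₁ σ₂ L₁ L₂ s₁ s₂ c :=
  bilayerWallAt_of_charges_zero hσ₁ hσ₂ L₁ L₂ s₁ s₂ R₀ hR₀ fun i j => hadm.2.2.2 i j (heq i j)

/-- **Both plates cut from ONE presented stacking** (`L₁ = L₂`, `s₁ = s₂`, `σ₁ = σ₂`; the co-Barlow / identical-crystal cell): for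
every table that vanishes on the DIAGONAL (`c i i = 0` — admissible tables do, the two facing frames of bilayer `i` being equal) and
is bounded, the cell inequality holds: off-diagonal slab pairs are disjoint, so the charge is `0`. -/
theorem bilayerWallAt_same_presentation {σ : ℤ → ℤ} (hσ : IsHaggSeq σ) (L : E3 ≃ₗᵢ[ℝ] E3) (s : E3) (R₀ : ℝ) (hR₀ : 3 ≤ R₀)
    {c : ℤ → ℤ → ℝ} (hdiag : ∀ i, c i i = 0) :
    BilayerWallAt ((3456 + 1152 * (R₀ + 1)) / 2) R₀ σ σ L L s s c := by
  intro h hh ρ hρ X P₁ P₂ hX hP₁X hP₂X hcyl hP₁def hP₂def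
  have key := bilayerWallAt_zero_table hσ hσ L L s s R₀ hR₀ h hh ρ hρ X P₁ P₂ hX hP₁X hP₂X hcyl hP₁def hP₂def
  have hQ : ∑' ij : ℤ × ℤ, c ij.1 ij.2 *
        (volume ({q : E3 | 0 ≤ q 2 ∧ q 2 ≤ 1 ∧ q 0 ^ 2 + q 1 ^ 2 ≤ ρ ^ 2} ∩ laySlab L s ij.1 ∩ laySlab L s ij.2)).toReal = 0 := by
    have hterm : ∀ ij : ℤ × ℤ, c ij.1 ij.2 *
        (volume ({q : E3 | 0 ≤ q 2 ∧ q 2 ≤ 1 ∧ q 0 ^ 2 + q 1 ^ 2 ≤ ρ ^ 2} ∩ laySlab L s ij.1 ∩ laySlab L s ij.2)).toReal = 0 := by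
      intro ij
      by_cases hij : ij.1 = ij.2
      · rw [hij, hdiag, zero_mul]
      · have hempty : ({q : E3 | 0 ≤ q 2 ∧ q 2 ≤ 1 ∧ q 0 ^ 2 + q 1 ^ 2 ≤ ρ ^ 2} ∩ laySlab L s ij.1 ∩ laySlab L s ij.2) = ∅ := by
          rw [Set.inter_assoc, Set.disjoint_iff_inter_eq_empty.1 (Summit.Ventures.Crystal3D.TentCertificate.disjoint_laySlab L s hij), Set.inter_empty]
        rw [hempty, measure_empty, ENNReal.toReal_zero, mul_zero]
    rw [tsum_congr hterm, tsum_zero]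
  simp only [zero_mul, tsum_zero] at key
  rw [hQ]
  exact key

end Summit.Ventures.Crystal3D.Theorems

end
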